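import Mathlib
import HarnessLib
import Summits.NavierStokesRegularity.NavierStokesRegularity.Theorems.QuarterLogPincerTruncationEdgeTransfer
import Summits.NavierStokesRegularity.NavierStokesRegularity.Theorems.QuarterLogPincerTruncationEdgeCutoffData
import Summits.NavierStokesRegularity.NavierStokesRegularity.Theorems.QuarterLogPincerTruncationEdgeFrameBootstrap
import Summits.NavierStokesRegularity.NavierStokesRegularity.Theorems.QuarterLogPincerTruncationEdgeSupShadowingCore
import Summits.NavierStokesRegularity.NavierStokesRegularity.Theorems.QuarterLogPincerTruncationEdgeSupShadowingProfile
import Summits.NavierStokesRegularity.NavierStokesRegularity.Theorems.QuarterLogPincerTruncationEdgeProfileIntegration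
import Summits.NavierStokesRegularity.NavierStokesRegularity.Theorems.QuarterLogPincerTruncationEdgeSupShadowingGlue
import Summits.NavierStokesRegularity.NavierStokesRegularity.Theorems.QuarterLogPincerTruncationEdgeExteriorCube
import Summits.NavierStokesRegularity.NavierStokesRegularity.Theorems.QuarterLogPincerTruncationEdgeAnatomy

/-!
# Route `QuarterLogPincer`, crux `TypeIQuantSubcubicExp` (stmt-NavierStokesRegularity-24077), EDGE line `truncation_edge`:
# **T1 `stub_farFieldTruncation : StubFarFieldTruncation` — PROVED; THE EDGE 24077 ⇒ 22144 UNCONDITIONAL, BY NAME**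

Assembly BY NAME (pub-ns-dss typer g35; `--supports stmt-NavierStokesRegularity-24077`, helper) of the landed T1 anatomy of line
`truncation_edge` (author ns-idea-7 g8/g9; objects `…TruncationEdgeDefs` p660448 [nsreg-C26-p1], `…TruncationEdgeAnatomyDefs` p669402/p670503):
P1 `stub_cutoffData` (`…CutoffData`, typer: cone-potential truncation) · P2 `stub_frameBootstrap` (`…FrameBootstrap`, author's proof) ·
P3a `stub_supShadowingCore` (`…SupShadowingCore`, typer's polynomial stability estimate) · P3b′ `stub_supShadowingProfile`
(`…SupShadowingProfile`, author's dyadic-radius bootstrap) · P3b′ ⇒ P3b `stubSupShadowingLocal_of_profile` (`…ProfileIntegration`, author) ·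
P3 = P3a ∘ P3b `stubSupShadowing_of_parts` (`…SupShadowingGlue`, author) · P4 `stub_exteriorCube` (`…ExteriorCube`, typer: interpolation) ·
the composition `stubFarFieldTruncation_of_anatomy` (`…Anatomy`, author) · the edge BY NAME modulo T1 (`…TruncationEdgeTransfer`, C26-p1:
T3/T4 landed as p660348/p660973).

* `stub_supShadowing : StubSupShadowing`, **`stub_farFieldTruncation : StubFarFieldTruncation`** — T1, the line's one remaining
  input (v1.0–v1.3 «THE INPUT»), is a THEOREM of the tree.
* **`edge_finiteDissipationLiouville : TypeIQuantSubcubicExp → FiniteDissipationLiouville`** — THE EDGE 24077 ⇒ item 22144, no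
  hypothesis left; likewise `edge_typeIDSSLiouvilleConjecture` (24077 ⇒ the catalogued wall `TypeIDSSLiouvilleConjecture`),
  `edge_noEnvelopedLeaf` (24077 ⇒ (E1⁺) `¬ EnvelopedLeaf M A` of 23843's factorisation), and THE INSTRUMENT ROW
  `not_typeIQuantSubcubicExp_of_isTypeIDSSProfile'` (ANY Type-I rotated `λ`-DSS profile REFUTES the crux 24077 itself).

READING for W7 / the wall board: «24077 sits in the sandwich ThinTowerLiouville ⇒ 24077 ⇒ EnvelopeLiouville (= 22144)» with BOTH
edges now kernel theorems (left: `…TypeIQuantSubcubicExpABRoot`; right: this file) — the residual of 24077 over the envelope-class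
Type-I Liouville wall is NIL.  HONEST FRAME: implications between OPEN statements about hypothetical Type-I objects; 24077, 22144,
`TypeIDSSLiouvilleConjecture`, 23843 and Navier–Stokes regularity are OPEN / NOT proved; nothing here bears on NS regularity itself.
-/

noncomputable section

-- the summit-side namespace repeats a component by design (D-0017)
set_option linter.dupNamespace false

namespace Summit.NavierStokesRegularity.NavierStokesRegularity.Cruxes.TypeIQuantSubcubicExp.TruncationEdge

open MeasureTheory Set Function Metric Filter Topology
open scoped ENNReal NNReal
open Literature.Analysis Literature.Analysis.FluidPDE
open Summit.NavierStokesRegularity.NavierStokesRegularity.Cruxes.TypeIQuantSubcubicExp.ThinCascade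
open Summit.NavierStokesRegularity.NavierStokesRegularity.Cruxes.ScarEnvelopeTypeI.ZoomDictionary

/-- **P3 PROVED** (`StubSupShadowing`): core P3a ∘ (profile P3b′ ⇒ localisation P3b). [this file; composition by name] -/
theorem stub_supShadowing : StubSupShadowing :=
  stubSupShadowing_of_parts stub_supShadowingCore (stubSupShadowingLocal_of_profile stub_supShadowingProfile)

/-- ★ **T1 PROVED — `stub_farFieldTruncation : StubFarFieldTruncation`** (finite-time far-field truncation stability of enveloped
Type-I ancient mild fields: P1 ∧ P2 ∧ P3 ∧ P4 and the author's composition, all tree theorems). [this file; composition by name] -/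
theorem stub_farFieldTruncation : StubFarFieldTruncation :=
  stubFarFieldTruncation_of_anatomy stub_cutoffData stub_frameBootstrap stub_supShadowing stub_exteriorCube

/-- ★★ **THE EDGE, UNCONDITIONAL: crux 24077 `TypeIQuantSubcubicExp` ⇒ item 22144 `FiniteDissipationLiouville`, BY NAME.**
[this file; composition by name over `…TruncationEdgeTransfer`] -/
theorem edge_finiteDissipationLiouville
    (hc : Summit.NavierStokesRegularity.NavierStokesRegularity.Theses.QuarterLogPincer.TypeIQuantSubcubicExp) :
    Summit.NavierStokesRegularity.NavierStokesRegularity.Theses.LerayQuarterDissipation.FiniteDissipationLiouville :=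
  finiteDissipationLiouville_of_typeIQuantSubcubicExp₁ stub_farFieldTruncation hc

/-- **24077 ⇒ the envelope-class Type-I Liouville statement** (no enveloped singular Type-I ancient mild object), unconditional.
[this file; composition by name] -/
theorem edge_envelopeLiouville
    (hc : Summit.NavierStokesRegularity.NavierStokesRegularity.Theses.QuarterLogPincer.TypeIQuantSubcubicExp) :
    ∀ (C A : ℝ) (w : ℝ → EuclideanSpace ℝ (Fin 3) → EuclideanSpace ℝ (Fin 3)),
      IsTypeIAncientMild C w → HasTypeIDecay A w →
      ¬ (∀ r > 0, ∀ M : ℝ, ∃ t ∈ Ioo (-(r ^ 2)) (0 : ℝ),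
          ∃ x ∈ ball (0 : EuclideanSpace ℝ (Fin 3)) r, M < ‖w t x‖) :=
  envelopeLiouville_of_typeIQuantSubcubicExp₁ stub_farFieldTruncation hc

/-- **24077 ⇒ the catalogued wall `TypeIDSSLiouvilleConjecture`**, unconditional. [this file; composition by name] -/
theorem edge_typeIDSSLiouvilleConjecture
    (hc : Summit.NavierStokesRegularity.NavierStokesRegularity.Theses.QuarterLogPincer.TypeIQuantSubcubicExp) :
    _root_.Summit.NavierStokesRegularity.NavierStokesRegularity.TypeIDSSLiouvilleConjecture :=
  typeIDSSLiouvilleConjecture_of_typeIQuantSubcubicExp₁ stub_farFieldTruncation hc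

/-- **24077 ⇒ (E1⁺) of 23843's factorisation: no enveloped leaf**, unconditional. [this file; composition by name] -/
theorem edge_noEnvelopedLeaf
    (hc : Summit.NavierStokesRegularity.NavierStokesRegularity.Theses.QuarterLogPincer.TypeIQuantSubcubicExp)
    (M A : ℝ) : ¬ EnvelopedLeaf M A :=
  noEnvelopedLeaf_of_typeIQuantSubcubicExp₁ stub_farFieldTruncation hc M A

/-- ★ **THE INSTRUMENT ROW AS A THEOREM**: any Type-I (rotated) `λ`-DSS profile (`IsTypeIDSSProfile c R u`, the pub-ns-dss census
object; Bradshaw–Tsai's open problem) REFUTES the crux 24077 — unconditionally. [this file; composition by name] -/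
theorem not_typeIQuantSubcubicExp_of_isTypeIDSSProfile' {c : ℝ}
    {R : EuclideanSpace ℝ (Fin 3) ≃ₗᵢ[ℝ] EuclideanSpace ℝ (Fin 3)}
    {u : ℝ → EuclideanSpace ℝ (Fin 3) → EuclideanSpace ℝ (Fin 3)} (hu : IsTypeIDSSProfile c R u) :
    ¬ Summit.NavierStokesRegularity.NavierStokesRegularity.Theses.QuarterLogPincer.TypeIQuantSubcubicExp :=
  not_typeIQuantSubcubicExp_of_isTypeIDSSProfile₁ stub_farFieldTruncation hu

end Summit.NavierStokesRegularity.NavierStokesRegularity.Cruxes.TypeIQuantSubcubicExp.TruncationEdge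

end
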